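import Literature.Geometry.Kaehler.AnalyticSetBranchLocus
import HarnessLib

/-!
# The local analytic cover of an analytic set under a linear projection with isolated fibre

Support for the proof of Lelong's theorem on the locally finite `𝓗^{2p}`-measure of complex
analytic sets (`Literature/Geometry/Kaehler/HolomorphicChainFacts.lean`,
`Lelong1957_hausdorffMeasure_inter_lt_top`). Let `A` be analytic on the open set `Ω` of a complex
normed space `E` of dimension `(m + 1) + p`, `a ∈ A`, and `ℓ : E → ℂᵖ` a linear surjection such
that the fibre of `ℓ|_A` through `a` is compact near `a` (this is what a generic linear change of
coordinates provides, [Chirka1989, §3.4 Lemma 2],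
`Literature.Geometry.Kaehler.SCV.exists_continuousLinearEquiv_forall_isCompact_inter_preimage`).
Straightening `ℓ` to the first projection of `ℂᵖ × ℂ^{m+1}`
(`Literature.Geometry.Kaehler.SCV.exists_equiv_fst_eq`) and setting up the local analytic cover
of [Chirka1989, §3.7] (`Literature.Analysis.Complex.SCV.exists_coverSetup`) we obtain
(`exists_projection_cover`): an open neighbourhood `P ⊆ Ω` of `a` such that

* the fibres of `ℓ` on `A ∩ P` have uniformly bounded cardinality (the root boxes of the cover,
  `Literature.Analysis.Complex.SCV.CoverSetup.card_rootBox_le`);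
* there is an analytic subset `B ⊆ A ∩ P` of `P` — the part of `A ∩ P` over the critical values
  `{Δ = 0}` of the cover (`Literature.Analysis.Complex.SCV.CoverSetup.exists_cover_structure`) —
  off which every point of `A ∩ P` is regular of codimension `m + 1`
  (`Literature.Analysis.Complex.SCV.CoverSetup.isRegPt_of_mem_coverZero`), and whose regular
  points all have codimension `> dim E - p`, i.e. `dim B ≤ p - 1`: a `p`-dimensional manifold
  piece of `B` would be mapped by `ℓ`, with finite fibres, onto a subset of `{Δ = 0}` with
  interior (`Literature.Geometry.Kaehler.SCV.exists_injective_fderiv_of_isolated`,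
  `Literature.Geometry.Kaehler.SCV.exists_map_nhds_eq_of_isolated`), but `Δ ≢ 0` near every point
  ([Chirka1989, §3.7 Thm.: "`π⁻¹(σ)` is nowhere dense in `A_(p)`", here in the form
  `dim (A ∩ π⁻¹(σ)) < p` of [Chirka1989, §3.6]).

The dimension statement in the straightened picture is `finrank_lt_of_isRegPt_coverZero_inter`.
Theorems only.

## References

* E. M. Chirka, *Complex Analytic Sets*, Kluwer (1989), §3.4 Lemma 2, §3.6, §3.7 Thm. (p. 40)
  [Chirka1989].
-/

open Complex Metric Set Filter Function
open scoped Topology Manifold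

namespace Literature.Geometry.Kaehler
namespace SCV

open Literature.Analysis.Complex.SCV (CoverSetup IsZeroSetAt)
open Literature.Analysis.Complex.SCV.CoverSetup

/-! ### Dimension of the part of the cover over the critical values -/

section Dimension

variable {m N p : ℕ} {f : (Fin p → ℂ) × (Fin (m + 1) → ℂ) → (Fin N → ℂ)} {a' : Fin p → ℂ}
  {a'' : Fin (m + 1) → ℂ} {ε r C : ℝ} {F : Fin (m + 1) → (Fin p → ℂ) × ℂ → ℂ}
  {rr RR : Fin (m + 1) → ℝ}

/-- **`dim (Z ∩ π⁻¹{Δ = 0}) < p`.** In the set-up `CoverSetup` over `ℂᵖ` with cover function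
`Δ` (`IsCoverDisc`), every regular point of the part `Z ∩ {Δ (z') = 0}` of the zero set
`Z = coverZero` over the critical values has codimension `q` with `dim - q < p`. Otherwise a
`≥ p`-dimensional manifold piece of it, parametrised by a holomorphic graph map `σ`
(`isGraphPointOver_of_isCompl_ker`), is mapped by `π ∘ σ` with isolated fibres (the fibres of the
cover are finite) into `{Δ = 0}`; by `exists_injective_fderiv_of_isolated` the piece has dimension
exactly `p`, and then `π ∘ σ` is open somewhere (`exists_map_nhds_eq_of_isolated`), so `Δ` would
vanish on an open set. [cite: Chirka1989, §3.7 Thm., p. 40] -/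
theorem finrank_lt_of_isRegPt_coverZero_inter (hS : CoverSetup f a' a'' ε r C F rr RR)
    {Δ : (Fin p → ℂ) → ℂ} (hΔ : IsCoverDisc f a' a'' ε r rr Δ)
    {x : (Fin p → ℂ) × (Fin (m + 1) → ℂ)} {q : ℕ}
    (hx : x ∈ regLocus (coverZero f a' a'' ε r ∩ {x | Δ x.1 = 0}))
    (hq : IsRegPt (coverZero f a' a'' ε r ∩ {x | Δ x.1 = 0}) q x) :
    Module.finrank ℂ ((Fin p → ℂ) × (Fin (m + 1) → ℂ)) < q + p := by
  classical
  set Z := coverZero f a' a'' ε r with hZ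
  set B := Z ∩ {x | Δ x.1 = 0} with hBdef
  have hxB : x ∈ B := regLocus_subset _ hx
  obtain ⟨U, hU, hxU, g, hg, hBU, hsurj⟩ := hq
  by_contra hle
  push Not at hle
  -- dimensions
  set n := Module.finrank ℂ ((Fin p → ℂ) × (Fin (m + 1) → ℂ)) with hn
  set T : Submodule ℂ ((Fin p → ℂ) × (Fin (m + 1) → ℂ)) :=
    LinearMap.ker (fderiv ℂ g x : ((Fin p → ℂ) × (Fin (m + 1) → ℂ)) →ₗ[ℂ] (Fin q → ℂ)) with hT
  have hTdim : Module.finrank ℂ T + q = n :=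
    finrank_ker_of_surjective
      (fderiv ℂ g x : ((Fin p → ℂ) × (Fin (m + 1) → ℂ)) →ₗ[ℂ] (Fin q → ℂ)) hsurj
  set d := Module.finrank ℂ T with hd
  have hpd : p ≤ d := by omega
  obtain ⟨μ, hμ, hcompl⟩ := exists_surjective_isCompl_ker T rfl
  obtain ⟨O, hO, hxO, O', hO', hOO', σ, hσ, hμσ, hBO⟩ :=
    isGraphPointOver_of_isCompl_ker hU hxU hg hBU hxB hsurj hμ hcompl
  -- parameters whose section values lie in `O`
  set Q : Set (Fin d → ℂ) := O' ∩ σ ⁻¹' O with hQ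
  have hQo : IsOpen Q := hσ.continuousOn.isOpen_inter_preimage hO' hO
  have hσx : σ (μ x) = x := (hBO.subset ⟨hxB, hxO⟩).2
  have hxQ : μ x ∈ Q := ⟨hOO' hxO, by rw [mem_preimage, hσx]; exact hxO⟩
  have hσB : ∀ u ∈ Q, σ u ∈ B := fun u hu => by
    have hfix : σ (μ (σ u)) = σ u := by rw [hμσ u hu.1]
    exact (hBO.symm.subset ⟨hu.2, hfix⟩).1
  have hσZ : ∀ u ∈ Q, σ u ∈ Z := fun u hu => (hσB u hu).1
  have hσΔ : ∀ u ∈ Q, Δ (σ u).1 = 0 := fun u hu => (hσB u hu).2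
  -- `g₂ = fst ∘ σ : Q → ℂᵖ` has isolated fibres
  set g₂ : (Fin d → ℂ) → (Fin p → ℂ) := fun u => (σ u).1 with hg₂
  have hg₂d : DifferentiableOn ℂ g₂ Q := (hσ.mono fun u hu => hu.1).fst
  have hiso : ∀ u ∈ Q, ∀ᶠ v in 𝓝[≠] u, g₂ v ≠ g₂ u := by
    intro u hu
    have hz' : (σ u).1 ∈ ball a' ε := (mem_coverZero_iff.1 (hσZ u hu)).1.1
    set Fu : Set (Fin (m + 1) → ℂ) := {w | w ∈ closedBall a'' r ∧ f ((σ u).1, w) = 0} with hFu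
    have hFuf : Fu.Finite := hS.finite_zeros hz'
    set Bad : Set (Fin d → ℂ) := Q ∩ σ ⁻¹' (({(σ u).1} : Set (Fin p → ℂ)) ×ˢ Fu) with hBad
    have hBadf : Bad.Finite := by
      refine Set.Finite.of_finite_image (f := σ) ?_ fun v hv v' hv' h => ?_
      · exact ((Set.finite_singleton _).prod hFuf).subset (by
          rintro _ ⟨v, hv, rfl⟩; exact hv.2)
      · rw [← hμσ v hv.1.1, ← hμσ v' hv'.1.1, h]
    have h1 : ∀ᶠ v in 𝓝 u, v ∉ Bad \ {u} :=
      (hBadf.subset Set.sdiff_subset).isClosed.isOpen_compl.mem_nhds fun h => h.2 rfl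
    rw [eventually_nhdsWithin_iff]
    filter_upwards [h1, hQo.mem_nhds hu] with v hv hvQ hne heq
    refine hv ⟨⟨hvQ, ?_⟩, hne⟩
    rw [mem_preimage, Set.mem_prod, mem_singleton_iff]
    have hvZ := mem_coverZero_iff.1 (hσZ v hvQ)
    refine ⟨heq, ball_subset_closedBall hvZ.1.2, ?_⟩
    have : f (σ v) = 0 := hvZ.2
    rwa [show σ v = ((σ u).1, (σ v).2) from Prod.ext heq rfl] at this
  -- the dimension of the piece is at most `p` …
  obtain ⟨u₁, hu₁Q, hinj⟩ := exists_injective_fderiv_of_isolated hQo ⟨μ x, hxQ⟩ hg₂d hiso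
  have hdp : d ≤ p := by
    have h := LinearMap.finrank_le_finrank_of_injective
      (f := (fderiv ℂ g₂ u₁ : (Fin d → ℂ) →ₗ[ℂ] (Fin p → ℂ))) hinj
    simpa using h
  have hdeq : d = p := le_antisymm hdp hpd
  -- … hence exactly `p`, and `g₂` is open somewhere: `Δ` vanishes near a point of the base ball
  have hdim : Module.finrank ℂ (Fin d → ℂ) = Module.finrank ℂ (Fin p → ℂ) := by simp [hdeq]
  obtain ⟨u, huQ, hmap⟩ := exists_map_nhds_eq_of_isolated hdim hQo ⟨μ x, hxQ⟩ hg₂d hiso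
  have himage : g₂ '' Q ∈ 𝓝 (g₂ u) := by
    rw [← hmap]; exact image_mem_map (hQo.mem_nhds huQ)
  have hΔ0 : Δ =ᶠ[𝓝 (g₂ u)] 0 := by
    filter_upwards [himage] with z hz
    obtain ⟨v, hv, rfl⟩ := hz
    exact hσΔ v hv
  exact hΔ.2.1 (g₂ u) (mem_coverZero_iff.1 (hσZ u huQ)).1.1 hΔ0

/-- The fibres of the first projection on the zero set of the cover have at most `K = boxBound`
points: a finite set of zeros over one base point lies in the root box. [folklore] -/
theorem card_le_boxBound_of_coverZero (hS : CoverSetup f a' a'' ε r C F rr RR)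
    (y : Fin p → ℂ) (S : Finset ((Fin p → ℂ) × (Fin (m + 1) → ℂ)))
    (hS₁ : ↑S ⊆ coverZero f a' a'' ε r) (hS₂ : ∀ x ∈ S, x.1 = y) : S.card ≤ hS.boxBound := by
  classical
  rcases S.eq_empty_or_nonempty with rfl | ⟨x₀, hx₀⟩
  · simp
  have hy : y ∈ ball a' ε := by
    rw [← hS₂ x₀ hx₀]; exact (mem_coverZero_iff.1 (hS₁ (Finset.mem_coe.2 hx₀))).1.1
  have hinj : Set.InjOn Prod.snd (S : Set ((Fin p → ℂ) × (Fin (m + 1) → ℂ))) := by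
    intro x hx x' hx' h
    exact Prod.ext ((hS₂ x hx).trans (hS₂ x' hx').symm) h
  calc S.card = (S.image Prod.snd).card := (Finset.card_image_of_injOn hinj).symm
    _ ≤ (Literature.Analysis.Complex.SCV.rootBox F a'' rr y).card := by
        refine Finset.card_le_card fun w hw => ?_
        obtain ⟨x, hx, rfl⟩ := Finset.mem_image.1 hw
        have hxZ := mem_coverZero_iff.1 (hS₁ (Finset.mem_coe.2 hx))
        have := hS.mem_rootBox_of_zero (x := (y, x.2))
          (mk_mem_prod hy (ball_subset_closedBall (by simpa [hS₂ x hx] using hxZ.1.2)))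
          (by rw [← hS₂ x hx]; exact hxZ.2)
        exact this
    _ ≤ hS.boxBound := hS.card_rootBox_le hy

end Dimension

/-! ### The cover for a linear surjection at a point with locally compact fibre -/

section Projection

variable {E : Type*} [NormedAddCommGroup E] [NormedSpace ℂ E] [FiniteDimensional ℂ E]

/-- Isolation of `a` in its `ℓ`-fibre on `A` near `a`, from compactness of the fibre near `a`
(the fibre is cut out by holomorphic equations, and compact analytic sets are finite,
[Chirka1989, §3.3 Prop. 1]). [folklore] -/
theorem eventually_ne_of_isCompact_fibre {p : ℕ} (ℓ : E →L[ℂ] (Fin p → ℂ)) {Ω A V₀ : Set E}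
    {a : E} (hAΩ : A ⊆ Ω) (hA : ∀ x ∈ Ω, IsZeroSetAt A x) (hV₀ : IsOpen V₀)
    (hK : IsCompact (A ∩ V₀ ∩ ℓ ⁻¹' {ℓ a})) :
    ∀ᶠ z in 𝓝[≠] a, z ∈ V₀ → z ∈ A → ℓ z ≠ ℓ a := by
  set Fb := A ∩ V₀ ∩ ℓ ⁻¹' {ℓ a} with hFb
  have hzs : ∀ z ∈ Fb, IsZeroSetAt Fb z := by
    rintro z ⟨⟨hzA, hzV₀⟩, -⟩
    have h1 : IsZeroSetAt A z := hA z (hAΩ hzA)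
    have h2 : IsZeroSetAt (V₀ ∩ ℓ ⁻¹' {ℓ a}) z := by
      refine ⟨V₀, hV₀, hzV₀, p, fun w => ℓ w - ℓ a,
        ℓ.differentiableOn.sub (differentiableOn_const _), ?_⟩
      ext w
      simp only [mem_inter_iff, mem_preimage, mem_singleton_iff, sub_eq_zero]
      tauto
    have h := (Literature.Analysis.Complex.SCV.isZeroSetAt_iff_isAnalyticSetAt.1 h1).inter
      (Literature.Analysis.Complex.SCV.isZeroSetAt_iff_isAnalyticSetAt.1 h2)
    rw [← inter_assoc] at h
    exact Literature.Analysis.Complex.SCV.isZeroSetAt_iff_isAnalyticSetAt.2 h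
  filter_upwards [eventually_notMem_of_isCompact_of_isZeroSetAt hK hzs a] with z hz hzV₀ hzA hℓ
  exact hz ⟨⟨hzA, hzV₀⟩, hℓ⟩

/-- **The local analytic cover of `A` for the projection `ℓ`.** Let `A` be analytic on the open
`Ω ⊆ E`, `dim E = (m + 1) + p`, `a ∈ A`, `ℓ : E → ℂᵖ` a linear surjection, and suppose the fibre
`A ∩ V₀ ∩ ℓ⁻¹(ℓ a)` is compact for some open `V₀ ∋ a`. Then there is an open `P ∋ a` inside `Ω`
such that (i) the fibres of `ℓ` on `A ∩ P` have at most `K` points, and (ii) there is a subset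
`B ⊆ A ∩ P`, analytic on `P`, such that every point of `A ∩ P` off `B` is regular of codimension
`m + 1`, and every regular point of `B` has codimension `q` with `dim E < q + p`
(`dim B < p`). The set `P` is the preimage of the polydisc of a local analytic cover
(`exists_coverSetup`) in coordinates straightening `ℓ` (`exists_equiv_fst_eq`), `K` the size of
its root boxes, and `B` the part of `A ∩ P` over the critical values `{Δ = 0}` of the cover
(`finrank_lt_of_isRegPt_coverZero_inter`). [cite: Chirka1989, §3.7 Thm., p. 40] -/
theorem exists_projection_cover {p m : ℕ} (hdim : Module.finrank ℂ E = (m + 1) + p)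
    {ℓ : E →L[ℂ] (Fin p → ℂ)} (hℓ : Function.Surjective ℓ) {Ω A V₀ : Set E} {a : E}
    (hΩ : IsOpen Ω) (hAΩ : A ⊆ Ω) (hA : ∀ x ∈ Ω, IsZeroSetAt A x) (haA : a ∈ A)
    (hV₀ : IsOpen V₀) (haV₀ : a ∈ V₀) (hK : IsCompact (A ∩ V₀ ∩ ℓ ⁻¹' {ℓ a})) :
    ∃ P : Set E, IsOpen P ∧ a ∈ P ∧ P ⊆ Ω ∧
      (∃ K : ℕ, ∀ y : Fin p → ℂ, ∀ S : Finset E, (↑S ⊆ A ∩ P) → (∀ z ∈ S, ℓ z = y) →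
        S.card ≤ K) ∧
      ∃ B : Set E, B ⊆ A ∩ P ∧ (∀ x ∈ P, IsZeroSetAt B x) ∧
        (∀ z ∈ A ∩ P, z ∉ B → IsRegPt A (m + 1) z) ∧
        (∀ x ∈ regLocus B, ∀ q, IsRegPt B q x → Module.finrank ℂ E < q + p) := by
  classical
  -- straighten `ℓ` to the first projection
  obtain ⟨Θ, hΘ⟩ := exists_equiv_fst_eq ℓ hℓ hdim
  set AX : Set ((Fin p → ℂ) × (Fin (m + 1) → ℂ)) := Θ '' A with hAXdef
  set ΩX : Set ((Fin p → ℂ) × (Fin (m + 1) → ℂ)) := Θ '' Ω with hΩXdef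
  have hΩX : IsOpen ΩX := Θ.toHomeomorph.isOpenMap Ω hΩ
  have hAX : ∀ y ∈ ΩX, IsZeroSetAt AX y := by
    rintro _ ⟨z, hz, rfl⟩
    exact (hA z hz).image_equiv Θ
  set aX : (Fin p → ℂ) × (Fin (m + 1) → ℂ) := Θ a with haXdef
  have haX1 : aX.1 = ℓ a := hΘ a
  have haXΩ : aX ∈ ΩX := ⟨a, hAΩ haA, rfl⟩
  -- `aX.2` is isolated in the fibre of `AX` over `aX.1`
  have hisoE : ∀ᶠ z in 𝓝[≠] a, z ∈ V₀ → z ∈ A → ℓ z ≠ ℓ a :=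
    eventually_ne_of_isCompact_fibre ℓ hAΩ hA hV₀ hK
  set φ : (Fin (m + 1) → ℂ) → E := fun w => Θ.symm (aX.1, w) with hφ
  have hφc : Continuous φ := Θ.symm.continuous.comp (continuous_const.prodMk continuous_id)
  have hΘφ : ∀ w, Θ (φ w) = (aX.1, w) := fun w => by simp [hφ]
  have hφa : φ aX.2 = a := by
    apply Θ.injective
    rw [hΘφ]
  have hφinj : Injective φ := fun w w' h => by
    have := congrArg (fun z => (Θ z).2) h
    simpa [hΘφ] using this
  have hℓφ : ∀ w, ℓ (φ w) = ℓ a := fun w => by rw [← hΘ, hΘφ, haX1]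
  have htend : Tendsto φ (𝓝[≠] aX.2) (𝓝[≠] a) := by
    refine tendsto_nhdsWithin_of_tendsto_nhds_of_eventually_within _ ?_ ?_
    · have : Tendsto φ (𝓝 aX.2) (𝓝 a) := by
        rw [← hφa]; exact hφc.continuousAt
      exact this.mono_left nhdsWithin_le_nhds
    · filter_upwards [self_mem_nhdsWithin] with w hw
      exact fun h => hw (hφinj (h.trans hφa.symm))
  have hisoX : ∀ᶠ w in 𝓝[≠] aX.2, (aX.1, w) ∉ AX := by
    have h1 : ∀ᶠ w in 𝓝[≠] aX.2, φ w ∈ V₀ → φ w ∈ A → ℓ (φ w) ≠ ℓ a := htend.eventually hisoE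
    have h2 : ∀ᶠ w in 𝓝 aX.2, φ w ∈ V₀ :=
      hφc.continuousAt.preimage_mem_nhds (by rw [hφa]; exact hV₀.mem_nhds haV₀)
    filter_upwards [h1, mem_nhdsWithin_of_mem_nhds h2] with w hw1 hw2 hwA
    have hφA : φ w ∈ A := by
      obtain ⟨z, hz, hzw⟩ := hwA
      have : z = φ w := Θ.injective (by rw [hzw, hΘφ])
      rwa [← this]
    exact hw1 hw2 hφA (hℓφ w)
  -- local equations of `AX` at `aX` and the cover set-up
  obtain ⟨U₀, hU₀, haU₀, N, g, hg, hAU₀⟩ := hAX aX haXΩ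
  have hiso' : ∀ᶠ w in 𝓝[≠] aX.2, g (aX.1, w) ≠ 0 := by
    have h3 : ∀ᶠ w in 𝓝 aX.2, (aX.1, w) ∈ U₀ :=
      (continuous_const.prodMk continuous_id).continuousAt.preimage_mem_nhds
        (hU₀.mem_nhds (by exact haU₀))
    filter_upwards [hisoX, mem_nhdsWithin_of_mem_nhds h3] with w hw hwU h0
    exact hw (hAU₀.symm.subset ⟨hwU, h0⟩).1
  obtain ⟨ε, r, C, F, rr, RR, hS, hsub⟩ :=
    Literature.Analysis.Complex.SCV.exists_coverSetup (hU₀.inter hΩX) (hg.mono inter_subset_left)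
      ⟨haU₀, haXΩ⟩ hiso'
  have hPD : polydisc aX.1 aX.2 ε r ⊆ U₀ ∩ ΩX := fun x hx =>
    hsub ⟨hx.1, ball_subset_closedBall hx.2⟩
  have hAXP : AX ∩ polydisc aX.1 aX.2 ε r = coverZero g aX.1 aX.2 ε r := by
    ext x
    rw [mem_coverZero_iff]
    constructor
    · rintro ⟨hxA, hxP⟩
      exact ⟨⟨hxP.1, hxP.2⟩, (hAU₀.subset ⟨hxA, (hPD hxP).1⟩).2⟩
    · rintro ⟨hxP, hgx⟩
      have hxP' : x ∈ polydisc aX.1 aX.2 ε r := ⟨hxP.1, hxP.2⟩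
      exact ⟨(hAU₀.symm.subset ⟨(hPD hxP').1, hgx⟩).1, hxP'⟩
  -- the neighbourhood `P`
  set P : Set E := Θ ⁻¹' polydisc aX.1 aX.2 ε r with hPdef
  have hPo : IsOpen P := isOpen_polydisc.preimage Θ.continuous
  have haP : a ∈ P := show Θ a ∈ polydisc aX.1 aX.2 ε r from
    ⟨mem_ball_self hS.ε_pos, mem_ball_self hS.r_pos⟩
  have hPΩ : P ⊆ Ω := fun z hz => by
    obtain ⟨z', hz', hzz'⟩ := (hPD hz).2
    rwa [← Θ.injective hzz']
  have hAP : ∀ z ∈ A ∩ P, Θ z ∈ coverZero g aX.1 aX.2 ε r := fun z hz => by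
    rw [← hAXP]; exact ⟨mem_image_of_mem Θ hz.1, hz.2⟩
  refine ⟨P, hPo, haP, hPΩ, ⟨hS.boxBound, fun y S hS₁ hS₂ => ?_⟩, ?_⟩
  · -- fibre bound, through `Θ`
    calc S.card = (S.image Θ).card := (Finset.card_image_of_injective _ Θ.injective).symm
      _ ≤ hS.boxBound := by
          refine card_le_boxBound_of_coverZero hS y _ ?_ ?_
          · intro x hx
            obtain ⟨z, hz, rfl⟩ := Finset.mem_image.1 (Finset.mem_coe.1 hx)
            exact hAP z (hS₁ (Finset.mem_coe.2 hz))
          · intro x hx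
            obtain ⟨z, hz, rfl⟩ := Finset.mem_image.1 hx
            rw [hΘ, hS₂ z hz]
  -- the bad set: the part of `A ∩ P` over the critical values of the cover
  obtain ⟨Δ, hΔ⟩ := hS.exists_isCoverDisc
  set B : Set E := {z ∈ A ∩ P | Δ (ℓ z) = 0} with hBdef
  have hℓP : ∀ z ∈ P, ℓ z ∈ ball aX.1 ε := fun z hz => by rw [← hΘ]; exact hz.1
  have hBX : Θ '' B = coverZero g aX.1 aX.2 ε r ∩ {x | Δ x.1 = 0} := by
    ext x
    constructor
    · rintro ⟨z, ⟨hzAP, hzΔ⟩, rfl⟩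
      exact ⟨hAP z hzAP, by rw [mem_setOf_eq, hΘ]; exact hzΔ⟩
    · rintro ⟨hxZ, hxΔ⟩
      have hxAX : x ∈ AX ∩ polydisc aX.1 aX.2 ε r := by rw [hAXP]; exact hxZ
      obtain ⟨z, hzA, rfl⟩ := hxAX.1
      refine ⟨z, ⟨⟨hzA, hxAX.2⟩, ?_⟩, rfl⟩
      rw [← hΘ]; exact hxΔ
  refine ⟨B, fun z hz => hz.1, fun x hxP => ?_, fun z hz hzB => ?_, fun x hx q hq => ?_⟩
  · -- `B` is analytic on `P`
    have h1 : IsZeroSetAt A x := hA x (hPΩ hxP)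
    have h2 : IsZeroSetAt (P ∩ {z | Δ (ℓ z) = 0}) x := by
      refine ⟨P, hPo, hxP, 1, fun z _ => Δ (ℓ z), ?_, ?_⟩
      · have hc : DifferentiableOn ℂ (fun z => Δ (ℓ z)) P :=
          hΔ.1.comp ℓ.differentiableOn fun z hz => hℓP z hz
        exact differentiableOn_pi.2 fun _ => hc
      · ext z
        simp only [mem_inter_iff, mem_setOf_eq, mem_preimage, mem_singleton_iff, funext_iff,
          Pi.zero_apply, Fin.forall_fin_one]
        tauto
    have h := (Literature.Analysis.Complex.SCV.isZeroSetAt_iff_isAnalyticSetAt.1 h1).inter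
      (Literature.Analysis.Complex.SCV.isZeroSetAt_iff_isAnalyticSetAt.1 h2)
    have hBeq : B = A ∩ (P ∩ {z | Δ (ℓ z) = 0}) := by
      ext z
      simp only [hBdef, mem_inter_iff, mem_setOf_eq]
      tauto
    rw [hBeq]
    exact Literature.Analysis.Complex.SCV.isZeroSetAt_iff_isAnalyticSetAt.2 h
  · -- regular points off `B`
    have hΔz : Δ (Θ z).1 ≠ 0 := by
      rw [hΘ]
      exact fun h0 => hzB ⟨hz, h0⟩
    have hreg := hS.isRegPt_of_mem_coverZero hΔ (hAP z hz) hΔz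
    have hregAX : IsRegPt AX (m + 1) (Θ z) :=
      hreg.congr isOpen_polydisc hz.2 (by rw [← hAXP, inter_assoc, inter_self])
    have h := hregAX.image_equiv Θ.symm
    simpa [hAXdef, Set.image_image] using h
  · -- dimension of `B`
    have hxB : x ∈ B := regLocus_subset _ hx
    have hq' : IsRegPt (coverZero g aX.1 aX.2 ε r ∩ {x | Δ x.1 = 0}) q (Θ x) := by
      rw [← hBX]; exact hq.image_equiv Θ
    have hx' : Θ x ∈ regLocus (coverZero g aX.1 aX.2 ε r ∩ {x | Δ x.1 = 0}) :=
      ⟨by rw [← hBX]; exact mem_image_of_mem Θ hxB, q, hq'⟩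
    have h := finrank_lt_of_isRegPt_coverZero_inter hS hΔ hx' hq'
    rwa [← Θ.toLinearEquiv.finrank_eq] at h

end Projection

end SCV
end Literature.Geometry.Kaehler
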